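import Mathlib
import Summits.Schanuel.Schanuel.Theorems.AclSubsetLogFreeCore.Negative.CoreAutConj
import Summits.Schanuel.Schanuel.Theorems.AclSubsetLogFreeCore.Negative.ExpAclDefinability
import Summits.Schanuel.Schanuel.Theorems.AclSubsetLogFreeCore.Negative.BranchParity
import Literature.NumberTheory.Transcendental.ExpAlgebraicNumbersProofs

/-!
# Crux `AclSubsetLogFreeCore` — rigidity of core automorphisms at `2πi`, `i`, `π`, `e`, `e^π`, `√2`, `ln 2`; mutation analysis of `stub_coreFixedField_logFree`

Drefute findings (line `eac-extends-core-automorphisms`, crux stmt-Schanuel-0968) about the residue stub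

  `stub_coreFixedField_logFree : ∀ a ∈ ecl ∅, (∀ g, IsEIsoOn g (ecl ∅) (ecl ∅) → g a = a) → a ∈ logFreeCore`

("the fixed field of `Aut_E(C₀)` is log-free", `C₀ = ecl ∅`), all PROVED (no `sorry`):

* every `g` with `IsEIsoOn g (ecl ∅) (ecl ∅)` is `ℚ`-linear on `C₀`, respects the kernel
  (`cexp (g u) = 1 ↔ cexp u = 1`), maps `2πi ↦ ±2πi` and `i ↦ ±i` WITH THE SAME SIGN, hence
  **fixes `π`** (`coreAut_map_pi`), `e`, `e^π`, `√2`, and moves `ln 2` only by a multiple of `4πi`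
  (`coreAut_exists_map_log_two`: the automorphism side of the Kummer parity of `BranchParity`);
* so the hypothesis of the stub HOLDS at `π`, `e`, `e^π` (all in `C_EA`: consistent) and FAILS at `2πi`
  (moved by `conj`): the stub survives every instance presently decidable;
* MUTATIONS: the hypothesis `a ∈ ecl ∅` is redundant (`mem_ecl_empty_of_forall_isEIsoOn_fixed`: a point
  outside `C₀` is moved by a junk modification of `id`); replacing the core by the `exp`-free
  `sInf coreFamilyNoExp ⊆ ℚ(π)^{ralg}` makes the stub FALSE (`stubCoreFixedField_false_without_expClosed`,
  witness `e^π`, Nesterenko), as does asking fixed elements to be algebraic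
  (`stubCoreFixedField_false_without_period_and_exp`, witness `e`, Hermite): any proof of the residue
  must use that `C_EA` is closed under `exp`, exactly as for the crux
  (`aclSubsetLogFreeCore_false_without_expClosed`).
-/

noncomputable section

set_option linter.dupNamespace false

open Literature.ModelTheory.ExponentialFields Literature.NumberTheory.Transcendental

namespace Summit.Schanuel.Schanuel.Theorems.AclSubsetLogFreeCore.Negative

/-! ## Classical constants lie in `C₀ = ecl ∅` -/

/-- Bridge from the tree's `IsExpAlgebraic`. -/
theorem mem_ecl_empty_of_isExpAlgebraic {a : ℂ} (ha : IsExpAlgebraic a) : a ∈ ecl (∅ : Set ℂ) :=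
  isExpAlgebraic_iff_mem_ecl_empty.1 ha

/-- `π ∈ C₀`. -/
theorem pi_mem_ecl_empty : (Real.pi : ℂ) ∈ ecl (∅ : Set ℂ) :=
  mem_ecl_empty_of_isExpAlgebraic isExpAlgebraic_pi

/-- `i ∈ C₀`. -/
theorem I_mem_ecl_empty : Complex.I ∈ ecl (∅ : Set ℂ) :=
  mem_ecl_empty_of_isExpAlgebraic isExpAlgebraic_I

/-- `ℚ ⊆ C₀`. -/
theorem ratCast_mem_ecl_empty (q : ℚ) : (q : ℂ) ∈ ecl (∅ : Set ℂ) :=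
  mem_ecl_empty_of_isExpAlgebraic (isExpAlgebraic_ratCast q)

/-- `2πi ∈ C₀`. -/
theorem two_pi_I_mem_ecl_empty : (2 * (Real.pi : ℂ) * Complex.I) ∈ ecl (∅ : Set ℂ) := by
  have h2 : ((2 : ℚ) : ℂ) ∈ ecl (∅ : Set ℂ) := ratCast_mem_ecl_empty 2
  have h2' : (2 : ℂ) ∈ ecl (∅ : Set ℂ) := by simpa using h2
  exact Khovanskii.mul_mem_ecl (Khovanskii.mul_mem_ecl h2' pi_mem_ecl_empty) I_mem_ecl_empty

/-- `C₀` is closed under `Complex.exp`. -/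
theorem cexp_mem_ecl_empty {a : ℂ} (ha : a ∈ ecl (∅ : Set ℂ)) : Complex.exp a ∈ ecl (∅ : Set ℂ) := by
  have h := Khovanskii.exp_mem_ecl ha
  rwa [expRing_exp_apply] at h

/-- `ln 2 ∈ C₀`. -/
theorem log_two_mem_ecl_empty : (Real.log 2 : ℂ) ∈ ecl (∅ : Set ℂ) := by
  refine mem_ecl_empty_of_isExpAlgebraic (IsExpAlgebraic.of_exp ?_)
  rw [exp_log_two]
  simpa using isExpAlgebraic_ratCast 2

/-! ## Rigidity of a core automorphism on the kernel, `i` and `π` -/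

section CoreAut

variable {g : ℂ → ℂ}

/-- `g` commutes with `Complex.exp` on `C₀`. -/
theorem coreAut_map_cexp (hg : IsEIsoOn g (ecl (∅ : Set ℂ)) (ecl (∅ : Set ℂ))) {u : ℂ}
    (hu : u ∈ ecl (∅ : Set ℂ)) : g (Complex.exp u) = Complex.exp (g u) := by
  have h := hg.map_exp hu
  rwa [expRing_exp_apply, expRing_exp_apply] at h

/-- `g` fixes the rationals. -/
theorem coreAut_map_ratCast (hg : IsEIsoOn g (ecl (∅ : Set ℂ)) (ecl (∅ : Set ℂ))) (q : ℚ) :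
    g (q : ℂ) = q := by
  have h : hg.equiv (q : Khovanskii.eclSubfield (∅ : Set ℂ)) = q := map_ratCast hg.equiv q
  have h' := congrArg (fun x : Khovanskii.eclSubfield (∅ : Set ℂ) => (x : ℂ)) h
  simp only [IsEIsoOn.coe_equiv_apply] at h'
  have hq : ((q : Khovanskii.eclSubfield (∅ : Set ℂ)) : ℂ) = (q : ℂ) := rfl
  rwa [hq] at h'

/-- `g` is `ℚ`-linear on `C₀`. -/
theorem coreAut_map_ratCast_mul (hg : IsEIsoOn g (ecl (∅ : Set ℂ)) (ecl (∅ : Set ℂ))) (q : ℚ)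
    {u : ℂ} (hu : u ∈ ecl (∅ : Set ℂ)) : g ((q : ℂ) * u) = (q : ℂ) * g u := by
  rw [hg.map_mul (ratCast_mem_ecl_empty q) hu, coreAut_map_ratCast hg]

/-- `g` respects the kernel of `exp` (both ways). -/
theorem coreAut_cexp_eq_one_iff (hg : IsEIsoOn g (ecl (∅ : Set ℂ)) (ecl (∅ : Set ℂ))) {u : ℂ}
    (hu : u ∈ ecl (∅ : Set ℂ)) : Complex.exp (g u) = 1 ↔ Complex.exp u = 1 := by
  rw [← coreAut_map_cexp hg hu]
  constructor
  · intro h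
    have h1 : g (Complex.exp u) = g 1 := by rw [h, hg.map_one]
    exact hg.bijOn.injOn (cexp_mem_ecl_empty hu) (Khovanskii.one_mem_ecl _) h1
  · intro h
    rw [h, hg.map_one]

/-- **`g (2πi) = ±2πi`**: `g` restricts to an automorphism of the kernel `2πiℤ`. -/
theorem coreAut_map_two_pi_I (hg : IsEIsoOn g (ecl (∅ : Set ℂ)) (ecl (∅ : Set ℂ))) :
    g (2 * (Real.pi : ℂ) * Complex.I) = (2 * (Real.pi : ℂ) * Complex.I) ∨ g (2 * (Real.pi : ℂ) * Complex.I) = -(2 * (Real.pi : ℂ) * Complex.I) := by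
  have htmem : (2 * (Real.pi : ℂ) * Complex.I) ∈ ecl (∅ : Set ℂ) := two_pi_I_mem_ecl_empty
  -- `exp (g (2 * (Real.pi : ℂ) * Complex.I)) = 1`, so `g (2 * (Real.pi : ℂ) * Complex.I) = n (2 * (Real.pi : ℂ) * Complex.I)`
  have h1 : Complex.exp (g (2 * (Real.pi : ℂ) * Complex.I)) = 1 := (coreAut_cexp_eq_one_iff hg htmem).2 Complex.exp_two_pi_mul_I
  obtain ⟨n, hn⟩ := Complex.exp_eq_one_iff.1 h1
  -- `(2 * (Real.pi : ℂ) * Complex.I) = g s` with `exp s = 1`, so `s = m (2 * (Real.pi : ℂ) * Complex.I)`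
  obtain ⟨s, hs, hst⟩ := hg.bijOn.surjOn htmem
  have h2 : Complex.exp s = 1 :=
    (coreAut_cexp_eq_one_iff hg hs).1 (by rw [hst]; exact Complex.exp_two_pi_mul_I)
  obtain ⟨m, hm⟩ := Complex.exp_eq_one_iff.1 h2
  -- `(2 * (Real.pi : ℂ) * Complex.I) = g (m (2 * (Real.pi : ℂ) * Complex.I)) = m g (2 * (Real.pi : ℂ) * Complex.I) = m n (2 * (Real.pi : ℂ) * Complex.I)`
  have h3 : g s = (m : ℂ) * g (2 * (Real.pi : ℂ) * Complex.I) := by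
    have : s = ((m : ℚ) : ℂ) * (2 * (Real.pi : ℂ) * Complex.I) := by rw [hm]; push_cast; ring
    rw [this, coreAut_map_ratCast_mul hg (m : ℚ) htmem]; push_cast; ring
  have hmn : (m : ℂ) * n = 1 := by
    have h4 : ((m : ℂ) * n - 1) * (2 * (Real.pi : ℂ) * Complex.I) = 0 := by
      have h5 : (m : ℂ) * g (2 * (Real.pi : ℂ) * Complex.I) = (2 * (Real.pi : ℂ) * Complex.I) := h3 ▸ hst
      rw [hn] at h5
      linear_combination h5
    rcases mul_eq_zero.1 h4 with h4 | h4
    · linear_combination h4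
    · exact absurd h4 two_pi_I_ne_zero'
  have hmn' : m * n = 1 := by exact_mod_cast hmn
  rcases Int.eq_one_or_neg_one_of_mul_eq_one' hmn' with ⟨-, rfl⟩ | ⟨-, rfl⟩
  · left; rw [hn]; push_cast; ring
  · right; rw [hn]; push_cast; ring

/-- `g (2πi) = ε · 2πi` and `g i = ε · i` with the SAME sign `ε = ±1` (`i = e^{2πi/4}`). -/
theorem coreAut_map_two_pi_I_and_map_I (hg : IsEIsoOn g (ecl (∅ : Set ℂ)) (ecl (∅ : Set ℂ))) :
    (g (2 * (Real.pi : ℂ) * Complex.I) = (2 * (Real.pi : ℂ) * Complex.I) ∧ g Complex.I = Complex.I) ∨ (g (2 * (Real.pi : ℂ) * Complex.I) = -(2 * (Real.pi : ℂ) * Complex.I) ∧ g Complex.I = -Complex.I) := by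
  have htmem : (2 * (Real.pi : ℂ) * Complex.I) ∈ ecl (∅ : Set ℂ) := two_pi_I_mem_ecl_empty
  have hq : ((1 / 4 : ℚ) : ℂ) * (2 * (Real.pi : ℂ) * Complex.I) = ↑(Real.pi / 2) * Complex.I := by push_cast; ring
  have hqn : ((1 / 4 : ℚ) : ℂ) * (-(2 * (Real.pi : ℂ) * Complex.I)) = -(↑(Real.pi / 2) * Complex.I) := by push_cast; ring
  have hI : Complex.I = Complex.exp (((1 / 4 : ℚ) : ℂ) * (2 * (Real.pi : ℂ) * Complex.I)) := by rw [hq, exp_pi_div_two_I]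
  have hgI : g Complex.I = Complex.exp (((1 / 4 : ℚ) : ℂ) * g (2 * (Real.pi : ℂ) * Complex.I)) := by
    conv_lhs => rw [hI]
    rw [coreAut_map_cexp hg (Khovanskii.mul_mem_ecl (ratCast_mem_ecl_empty _) htmem),
      coreAut_map_ratCast_mul hg _ htmem]
  rcases coreAut_map_two_pi_I hg with h | h
  · left
    refine ⟨h, ?_⟩
    rw [hgI, h, hq, exp_pi_div_two_I]
  · right
    refine ⟨h, ?_⟩
    rw [hgI, h, hqn, exp_neg_pi_div_two_I]

/-- **Every automorphism of the countable core fixes `π`.** -/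
theorem coreAut_map_pi (hg : IsEIsoOn g (ecl (∅ : Set ℂ)) (ecl (∅ : Set ℂ))) :
    g (Real.pi : ℂ) = Real.pi := by
  have hpi : (Real.pi : ℂ) = ((-1 / 2 : ℚ) : ℂ) * Complex.I * (2 * (Real.pi : ℂ) * Complex.I) := by
    push_cast
    linear_combination (Real.pi : ℂ) * Complex.I_mul_I
  have hmem1 : ((-1 / 2 : ℚ) : ℂ) * Complex.I ∈ ecl (∅ : Set ℂ) :=
    Khovanskii.mul_mem_ecl (ratCast_mem_ecl_empty _) I_mem_ecl_empty
  rw [hpi, hg.map_mul hmem1 two_pi_I_mem_ecl_empty, coreAut_map_ratCast_mul hg _ I_mem_ecl_empty]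
  rcases coreAut_map_two_pi_I_and_map_I hg with ⟨ht, hI⟩ | ⟨ht, hI⟩
  · rw [ht, hI]
  · rw [ht, hI]; ring

/-- `g` fixes `e^π`. -/
theorem coreAut_map_cexp_pi (hg : IsEIsoOn g (ecl (∅ : Set ℂ)) (ecl (∅ : Set ℂ))) :
    g (Complex.exp Real.pi) = Complex.exp Real.pi := by
  rw [coreAut_map_cexp hg pi_mem_ecl_empty, coreAut_map_pi hg]

/-- `g` fixes `e`. -/
theorem coreAut_map_cexp_one (hg : IsEIsoOn g (ecl (∅ : Set ℂ)) (ecl (∅ : Set ℂ))) :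
    g (Complex.exp 1) = Complex.exp 1 := by
  rw [coreAut_map_cexp hg (Khovanskii.one_mem_ecl _), hg.map_one]

/-- `g` fixes `√2 = e^{πi/4} + e^{-πi/4}` (a real abelian number). -/
theorem coreAut_map_sqrt_two (hg : IsEIsoOn g (ecl (∅ : Set ℂ)) (ecl (∅ : Set ℂ))) :
    g (Real.sqrt 2 : ℂ) = Real.sqrt 2 := by
  have htmem : (2 * (Real.pi : ℂ) * Complex.I) ∈ ecl (∅ : Set ℂ) := two_pi_I_mem_ecl_empty
  have humem : ((1 / 8 : ℚ) : ℂ) * (2 * (Real.pi : ℂ) * Complex.I) ∈ ecl (∅ : Set ℂ) :=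
    Khovanskii.mul_mem_ecl (ratCast_mem_ecl_empty _) htmem
  have hu' : ((1 / 8 : ℚ) : ℂ) * (2 * (Real.pi : ℂ) * Complex.I) = ↑(Real.pi / 4) * Complex.I := by push_cast; ring
  have hsqrt : (Real.sqrt 2 : ℂ) =
      Complex.exp (((1 / 8 : ℚ) : ℂ) * (2 * (Real.pi : ℂ) * Complex.I)) + Complex.exp (-(((1 / 8 : ℚ) : ℂ) * (2 * (Real.pi : ℂ) * Complex.I))) :=
    (exp_add_exp_neg_pi_div_four _ (Or.inl hu')).symm
  have key : g (Real.sqrt 2 : ℂ) =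
      Complex.exp (((1 / 8 : ℚ) : ℂ) * g (2 * (Real.pi : ℂ) * Complex.I)) + Complex.exp (-(((1 / 8 : ℚ) : ℂ) * g (2 * (Real.pi : ℂ) * Complex.I))) := by
    conv_lhs => rw [hsqrt]
    rw [hg.map_add (cexp_mem_ecl_empty humem) (cexp_mem_ecl_empty (Khovanskii.neg_mem_ecl humem)),
      coreAut_map_cexp hg humem, coreAut_map_cexp hg (Khovanskii.neg_mem_ecl humem), hg.map_neg humem,
      coreAut_map_ratCast_mul hg _ htmem]
  rw [key]
  rcases coreAut_map_two_pi_I hg with h | h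
  · rw [h]
    exact exp_add_exp_neg_pi_div_four _ (Or.inl hu')
  · rw [h]
    exact exp_add_exp_neg_pi_div_four (((1 / 8 : ℚ) : ℂ) * (-(2 * (Real.pi : ℂ) * Complex.I))) (Or.inr (by push_cast; ring))

/-- **Kummer parity on the automorphism side**: a core automorphism moves `ln 2` by a multiple of
`4πi` (it fixes `√2 = e^{(ln 2)/2}`), in agreement with `not_branchIndiscernibility`. -/
theorem coreAut_exists_map_log_two (hg : IsEIsoOn g (ecl (∅ : Set ℂ)) (ecl (∅ : Set ℂ))) :
    ∃ k : ℤ, g (Real.log 2 : ℂ) = Real.log 2 + k * (2 * (2 * (Real.pi : ℂ) * Complex.I)) := by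
  have hLmem : (Real.log 2 : ℂ) ∈ ecl (∅ : Set ℂ) := log_two_mem_ecl_empty
  -- `exp (g L) = g 2 = 2 = exp L`
  have h2 : g (2 : ℂ) = 2 := by simpa using coreAut_map_ratCast hg 2
  have hexp : Complex.exp (g (Real.log 2 : ℂ)) = Complex.exp (Real.log 2 : ℂ) := by
    rw [← coreAut_map_cexp hg hLmem, exp_log_two, h2]
  obtain ⟨n, hn⟩ := Complex.exp_eq_exp_iff_exists_int.1 hexp
  -- halve: `exp (g (L/2)) = g √2 = √2 = exp (L/2)`
  have hhalf : ((1 / 2 : ℚ) : ℂ) * (Real.log 2 : ℂ) = (Real.log 2 : ℂ) / 2 := by push_cast; ring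
  have hL2mem : (Real.log 2 : ℂ) / 2 ∈ ecl (∅ : Set ℂ) := by
    rw [← hhalf]; exact Khovanskii.mul_mem_ecl (ratCast_mem_ecl_empty _) hLmem
  have hexp2 : Complex.exp (g ((Real.log 2 : ℂ) / 2)) = Complex.exp ((Real.log 2 : ℂ) / 2) := by
    rw [← coreAut_map_cexp hg hL2mem, exp_half_log_two, coreAut_map_sqrt_two hg]
  have hgL2 : g ((Real.log 2 : ℂ) / 2) = g (Real.log 2 : ℂ) / 2 := by
    rw [← hhalf, coreAut_map_ratCast_mul hg _ hLmem]; push_cast; ring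
  rw [hgL2, hn] at hexp2
  have hkey : Complex.exp ((n : ℂ) * (↑Real.pi * Complex.I)) = 1 := by
    have e1 : ((Real.log 2 : ℂ) + n * (2 * ↑Real.pi * Complex.I)) / 2 =
        (Real.log 2 : ℂ) / 2 + n * (↑Real.pi * Complex.I) := by ring
    rw [e1, Complex.exp_add] at hexp2
    exact (mul_eq_left₀ (Complex.exp_ne_zero _)).1 hexp2
  obtain ⟨m, hm⟩ := Complex.exp_eq_one_iff.1 hkey
  have hπ : (↑Real.pi * Complex.I : ℂ) ≠ 0 := by
    simp [Real.pi_ne_zero, Complex.I_ne_zero]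
  have hnm : (n : ℂ) = 2 * m := by
    have : ((n : ℂ) - 2 * m) * (↑Real.pi * Complex.I) = 0 := by linear_combination hm
    rcases mul_eq_zero.1 this with h | h
    · linear_combination h
    · exact absurd h hπ
  refine ⟨m, ?_⟩
  rw [hn, hnm]; ring

end CoreAut

/-! ## Mutation analysis of `stub_coreFixedField_logFree` -/

/-- The hypothesis `a ∈ ecl ∅` of the stub is REDUNDANT: a point fixed by every map that is an
E-automorphism ON `C₀` already lies in `C₀` (outside `C₀` such maps are unconstrained: modify `id`
at `a` only). -/
theorem mem_ecl_empty_of_forall_isEIsoOn_fixed {a : ℂ}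
    (hfix : ∀ g : ℂ → ℂ, IsEIsoOn g (ecl (∅ : Set ℂ)) (ecl (∅ : Set ℂ)) → g a = a) :
    a ∈ ecl (∅ : Set ℂ) := by
  by_contra ha
  have hg_of : ∀ x ∈ ecl (∅ : Set ℂ), Function.update id a (a + 1) x = x := fun x hx => by
    have hxa : x ≠ a := fun h => ha (h ▸ hx)
    rw [Function.update_of_ne hxa]; rfl
  have hg : IsEIsoOn (Function.update id a (a + 1)) (ecl (∅ : Set ℂ)) (ecl (∅ : Set ℂ)) := by
    refine ⟨⟨fun x hx => ?_, fun x hx y hy hxy => ?_, fun y hy => ⟨y, hy, hg_of y hy⟩⟩,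
      fun u v hu hv => ?_, fun u v hu hv => ?_, fun u hu => ?_⟩
    · rw [hg_of x hx]; exact hx
    · rwa [hg_of x hx, hg_of y hy] at hxy
    · rw [hg_of _ (Khovanskii.add_mem_ecl hu hv), hg_of u hu, hg_of v hv]
    · rw [hg_of _ (Khovanskii.mul_mem_ecl hu hv), hg_of u hu, hg_of v hv]
    · rw [hg_of _ (Khovanskii.exp_mem_ecl hu), hg_of u hu]
  have h := hfix _ hg
  rw [Function.update_self] at h
  have : (1 : ℂ) = 0 := by linear_combination h
  exact one_ne_zero this

/-- The stub's hypothesis HOLDS at `π` … -/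
theorem forall_isEIsoOn_fixed_pi :
    ∀ g : ℂ → ℂ, IsEIsoOn g (ecl (∅ : Set ℂ)) (ecl (∅ : Set ℂ)) → g (Real.pi : ℂ) = Real.pi :=
  fun _ hg => coreAut_map_pi hg

/-- … at `e^π` … -/
theorem forall_isEIsoOn_fixed_cexp_pi :
    ∀ g : ℂ → ℂ, IsEIsoOn g (ecl (∅ : Set ℂ)) (ecl (∅ : Set ℂ)) →
      g (Complex.exp Real.pi) = Complex.exp Real.pi :=
  fun _ hg => coreAut_map_cexp_pi hg

/-- … and at `e` (all three lie in `C_EA`: consistent with the stub) … -/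
theorem forall_isEIsoOn_fixed_cexp_one :
    ∀ g : ℂ → ℂ, IsEIsoOn g (ecl (∅ : Set ℂ)) (ecl (∅ : Set ℂ)) →
      g (Complex.exp 1) = Complex.exp 1 :=
  fun _ hg => coreAut_map_cexp_one hg

/-- … and FAILS at `2πi` (moved by `conj`; `2πi ∈ C_EA` anyway). -/
theorem not_forall_isEIsoOn_fixed_two_pi_I :
    ¬ ∀ g : ℂ → ℂ, IsEIsoOn g (ecl (∅ : Set ℂ)) (ecl (∅ : Set ℂ)) → g (2 * (Real.pi : ℂ) * Complex.I) = (2 * (Real.pi : ℂ) * Complex.I) := fun h => by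
  obtain ⟨r, hr⟩ := exists_eq_ofReal_of_forall_isEIsoOn_fixed h
  have him := congrArg Complex.im hr
  simp [Real.pi_ne_zero] at him

/-- **Load-bearing: `exp`-closure of the core.** The residue stub with `C_EA` replaced by the
`exp`-free core `sInf coreFamilyNoExp` (relatively algebraically closed subfields containing `2πi`,
e.g. `Kpi = ℚ(π)^{ralg}`) is FALSE: `e^π ∈ C₀` is fixed by every core automorphism but is not
algebraic over `ℚ(π)` (Nesterenko, tree `exp_pi_not_mem_Kpi`). -/
theorem stubCoreFixedField_false_without_expClosed :
    ¬ (∀ a ∈ ecl (∅ : Set ℂ),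
        (∀ g : ℂ → ℂ, IsEIsoOn g (ecl (∅ : Set ℂ)) (ecl (∅ : Set ℂ)) → g a = a) →
          a ∈ ((sInf coreFamilyNoExp : IntermediateField ℚ ℂ) : Set ℂ)) := fun h => by
  have h1 := h _ (cexp_mem_ecl_empty pi_mem_ecl_empty) forall_isEIsoOn_fixed_cexp_pi
  have h2 : Complex.exp Real.pi ∈ Kpi :=
    IntermediateField.mem_sInf.1 (SetLike.mem_coe.1 h1) Kpi Kpi_mem_coreFamilyNoExp
  exact exp_pi_not_mem_Kpi h2

/-- **Load-bearing: the transcendental generators.** Fixed elements need not be algebraic: `e` is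
fixed by every core automorphism and transcendental (Hermite, tree `transcendental_rat_cexp_one`). -/
theorem stubCoreFixedField_false_without_period_and_exp :
    ¬ (∀ a ∈ ecl (∅ : Set ℂ),
        (∀ g : ℂ → ℂ, IsEIsoOn g (ecl (∅ : Set ℂ)) (ecl (∅ : Set ℂ)) → g a = a) →
          IsAlgebraic ℚ a) := fun h =>
  Literature.NumberTheory.Transcendental.transcendental_rat_cexp_one
    (h _ (cexp_mem_ecl_empty (Khovanskii.one_mem_ecl _)) forall_isEIsoOn_fixed_cexp_one)

end Summit.Schanuel.Schanuel.Theorems.AclSubsetLogFreeCore.Negative
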